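import Mathlib.LinearAlgebra.Eigenspace.Triangularizable
import Mathlib.Algebra.DirectSum.Module
import Mathlib.Data.Nat.Factorization.Basic
import Mathlib.Analysis.Complex.Polynomial.Basic
import HarnessLib

/-!
# Landsberg–Ressayre, Thm. 2.8 — step (B3): the grading defined by ONE generic torus element

Topic `Literature/Computability/AlgebraicComplexity`.  Third file of the bottom-up proof of
`lr_left_equivariant_lower` (LR17 Thm. 2.8; plan in `LandsbergRessayreNormalForm.lean`).  In LR17
§6 the torus `T = T^{GL(E)}` is lifted to a central torus `T̃` of a reductive group `L'` and the
representation is decomposed into `T̃`-weight spaces.  Step (B3) of the elementary reformulation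
replaces this by the generalised eigenspaces of the lift `(P, Q)` of a SINGLE torus element
`t = diag(p₁, …, p_m)` with `p_i` distinct primes:

* `pow_sub_comp_eq_smul_comp_pow_sub`, `mapsTo_maxGenEigenspace_of_comp_eq_smul`: if
  `P ∘ M = c • (M ∘ Q)` then `M` maps the generalised `β`-eigenspace of `Q` into the generalised
  `cβ`-eigenspace of `P` (all linear algebra over a field);
* `tpow p e = ∏ p_i ^ e_i` (`e ∈ ℤ^m`) is injective in `e` for an injective family of primes
  (`tpow_injective`, unique factorisation), so that every complex number `z` gets a **degree**
  `deg p z ∈ ℤ^m` relative to a chosen representative of its class modulo `tpow p (ℤ^m)` (an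
  unspecified junk value for `z = 0`), with `deg p (z * tpow p e) = deg p z + e` for `z ≠ 0`
  (`deg_mul_tpow`); these live in the sub-namespace `Literature.CplxAlg.TorusGrading`;
* `isInternal_fiber`: regrouping an internal direct sum along a map of index types;
* `gradedPiece p Q d = ⨆_{deg β = d} (gen. eigenspace of Q at β)`, an internal direct sum
  decomposition of the space indexed by `ℤ^m` (`gradedPiece_isInternal`), and the degree shift
  `M (gradedPiece p Q d) ≤ gradedPiece p P (d + e)` when `P ∘ M = tpow p e • (M ∘ Q)` and `Q` is
  injective (`map_gradedPiece_le`).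

Applied (in the next files) to `Λ` (`e = 0`) and to the coefficient matrices `A_{ij}` of the
row-`i` variables (`e = e_i`), this grades source and target of `Ã = Λ + A` by `ℤ^m` with `Λ` of
degree `0` and the row-`i` part of degree `e_i` — the weight-space decomposition of LR17 §6
without algebraic groups.  Nothing here is specific to the permanent. [folklore]

## References

* J. M. Landsberg, N. Ressayre, *Permanent v. determinant: an exponential lower bound assuming
  symmetry and a potential path towards Valiant's conjecture*, Differential Geom. Appl. 55 (2017)
  146–166, arXiv:1508.05788, §6 (weights of `T̃`).
-/

noncomputable section

namespace Literature.Computability.AlgebraicComplexity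

/-! ### Intertwining up to a scalar shifts generalised eigenspaces -/

section EigenMap

variable {K : Type*} [Field K] {V W : Type*} [AddCommGroup V] [Module K V] [AddCommGroup W]
  [Module K W]

/-- If `P ∘ M = c • (M ∘ Q)` then `(P - cβ)^k ∘ M = c^k • (M ∘ (Q - β)^k)`. [folklore] -/
theorem pow_sub_comp_eq_smul_comp_pow_sub (P : Module.End K W) (Q : Module.End K V) (M : V →ₗ[K] W)
    (c : K) (h : P ∘ₗ M = c • (M ∘ₗ Q)) (β : K) (k : ℕ) :
    ((P - (c * β) • (1 : Module.End K W)) ^ k) ∘ₗ M =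
      c ^ k • (M ∘ₗ ((Q - β • (1 : Module.End K V)) ^ k)) := by
  have h' : ∀ v, P (M v) = c • M (Q v) := fun v => by
    have := LinearMap.congr_fun h v
    simpa using this
  have step : (P - (c * β) • (1 : Module.End K W)) ∘ₗ M =
      c • (M ∘ₗ (Q - β • (1 : Module.End K V))) := by
    ext v
    simp only [LinearMap.comp_apply, LinearMap.sub_apply, LinearMap.smul_apply,
      Module.End.one_apply, h', map_sub, map_smul, smul_sub, mul_smul]
  induction k with
  | zero =>
    ext v; simp
  | succ k ih =>
    rw [pow_succ, Module.End.mul_eq_comp, LinearMap.comp_assoc, step, LinearMap.comp_smul,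
      ← LinearMap.comp_assoc, ih, LinearMap.smul_comp, smul_smul, LinearMap.comp_assoc,
      ← Module.End.mul_eq_comp, ← pow_succ, ← pow_succ']

/-- **Intertwining up to a scalar shifts generalised eigenspaces**: if `P ∘ M = c • (M ∘ Q)` then
`M` maps the generalised `β`-eigenspace of `Q` into the generalised `cβ`-eigenspace of `P`.
(For `c = 1` this is the familiar statement for intertwiners.) [folklore] -/
theorem mapsTo_maxGenEigenspace_of_comp_eq_smul (P : Module.End K W) (Q : Module.End K V)
    (M : V →ₗ[K] W) (c : K) (h : P ∘ₗ M = c • (M ∘ₗ Q)) (β : K) :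
    Set.MapsTo M (Q.maxGenEigenspace β) (P.maxGenEigenspace (c * β)) := by
  intro v hv
  rw [SetLike.mem_coe, Module.End.mem_maxGenEigenspace] at hv ⊢
  obtain ⟨k, hk⟩ := hv
  refine ⟨k, ?_⟩
  have := LinearMap.congr_fun (pow_sub_comp_eq_smul_comp_pow_sub P Q M c h β k) v
  simp only [LinearMap.comp_apply, LinearMap.smul_apply] at this
  rw [this, hk, map_zero, smul_zero]

/-- Submodule form of `mapsTo_maxGenEigenspace_of_comp_eq_smul`. [folklore] -/
theorem map_maxGenEigenspace_le_of_comp_eq_smul (P : Module.End K W) (Q : Module.End K V)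
    (M : V →ₗ[K] W) (c : K) (h : P ∘ₗ M = c • (M ∘ₗ Q)) (β : K) :
    (Q.maxGenEigenspace β).map M ≤ P.maxGenEigenspace (c * β) :=
  Submodule.map_le_iff_le_comap.2 fun _ hv => mapsTo_maxGenEigenspace_of_comp_eq_smul P Q M c h β hv

/-- An injective endomorphism has trivial generalised `0`-eigenspace. [folklore] -/
theorem maxGenEigenspace_zero_eq_bot_of_injective (Q : Module.End K V) (hQ : Function.Injective Q) :
    Q.maxGenEigenspace 0 = ⊥ := by
  rw [eq_bot_iff]
  intro v hv
  rw [Module.End.mem_maxGenEigenspace] at hv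
  obtain ⟨k, hk⟩ := hv
  rw [zero_smul, sub_zero] at hk
  rw [Submodule.mem_bot]
  have hinj : Function.Injective (Q ^ k) := by
    rw [Module.End.coe_pow]; exact Function.Injective.iterate hQ k
  exact hinj (by rw [hk, map_zero])

end EigenMap

/-! ### Prime-power characters and the degree of a complex number -/

namespace TorusGrading

section PrimeWeights

open Finset

variable {m : ℕ}

/-- `t^e = ∏_i p_i ^ e_i` for `e ∈ ℤ^m`: the value at `e` of the character lattice of the torus
element `t = diag(p₁, …, p_m)`. [folklore] -/
def tpow (p : Fin m → ℕ) (e : Fin m → ℤ) : ℂ := ∏ i, (p i : ℂ) ^ (e i)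

variable {p : Fin m → ℕ}

/-- `t^0 = 1`. [folklore] -/
@[simp] theorem tpow_zero : tpow p 0 = 1 := by simp [tpow]

/-- `t^e ≠ 0`. [folklore] -/
theorem tpow_ne_zero (hp0 : ∀ i, p i ≠ 0) (e : Fin m → ℤ) : tpow p e ≠ 0 :=
  prod_ne_zero_iff.2 fun i _ => zpow_ne_zero _ (Nat.cast_ne_zero.2 (hp0 i))

/-- `t^{e+e'} = t^e t^{e'}`. [folklore] -/
theorem tpow_add (hp0 : ∀ i, p i ≠ 0) (e e' : Fin m → ℤ) : tpow p (e + e') = tpow p e * tpow p e' := by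
  simp only [tpow, Pi.add_apply, ← prod_mul_distrib]
  exact prod_congr rfl fun i _ => zpow_add₀ (Nat.cast_ne_zero.2 (hp0 i)) _ _

/-- `t^{-e} = (t^e)⁻¹`. [folklore] -/
theorem tpow_neg (e : Fin m → ℤ) : tpow p (-e) = (tpow p e)⁻¹ := by
  simp only [tpow, Pi.neg_apply, zpow_neg, prod_inv_distrib]

/-- `t^{e_i} = p_i`. [folklore] -/
@[simp] theorem tpow_single (i : Fin m) : tpow p (Pi.single i 1) = p i := by
  rw [tpow, prod_eq_single i]
  · simp
  · intro j _ hj; simp [Pi.single_eq_of_ne hj]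
  · simp

/-- Unique factorisation: for an injective family of primes, `∏ p_i^{a_i}` determines `a`. [folklore] -/
theorem eq_of_prod_prime_pow_eq (hp : ∀ i, (p i).Prime) (hinj : Function.Injective p)
    {a b : Fin m → ℕ} (h : ∏ i, p i ^ a i = ∏ i, p i ^ b i) : a = b := by
  have key : ∀ (a : Fin m → ℕ) (j : Fin m), (∏ i, p i ^ a i).factorization (p j) = a j := by
    intro a j
    rw [Nat.factorization_prod fun i _ => pow_ne_zero _ (hp i).ne_zero, Finsupp.finsetSum_apply]
    simp only [Nat.factorization_pow, Finsupp.smul_apply, smul_eq_mul]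
    rw [sum_eq_single j]
    · rw [(hp j).factorization, Finsupp.single_eq_same, mul_one]
    · intro i _ hij
      rw [(hp i).factorization, Finsupp.single_apply, if_neg (hinj.ne hij), mul_zero]
    · simp
  funext j
  rw [← key a j, ← key b j, h]

/-- `e ↦ t^e` is injective: the `p_i` are multiplicatively independent. [folklore] -/
theorem tpow_injective (hp : ∀ i, (p i).Prime) (hinj : Function.Injective p) :
    Function.Injective (tpow p) := by
  have hp0 : ∀ i, p i ≠ 0 := fun i => (hp i).ne_zero
  -- first: `tpow p e = 1 → e = 0`
  have h1 : ∀ e : Fin m → ℤ, tpow p e = 1 → e = 0 := by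
    intro e he
    set a : Fin m → ℕ := fun i => (e i).toNat with ha
    set b : Fin m → ℕ := fun i => (-e i).toNat with hb
    have hab : e = fun i => (a i : ℤ) - (b i : ℤ) := by
      funext i; simp only [ha, hb]; exact (Int.toNat_sub_toNat_neg (e i)).symm
    have hprod : (∏ i, (p i : ℂ) ^ (a i : ℤ)) = (∏ i, (p i : ℂ) ^ (b i : ℤ)) := by
      have hb0 : (∏ i, (p i : ℂ) ^ (b i : ℤ)) ≠ 0 :=
        prod_ne_zero_iff.2 fun i _ => zpow_ne_zero _ (Nat.cast_ne_zero.2 (hp0 i))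
      have : tpow p e * ∏ i, (p i : ℂ) ^ (b i : ℤ) = ∏ i, (p i : ℂ) ^ (a i : ℤ) := by
        rw [tpow, ← prod_mul_distrib]
        refine prod_congr rfl fun i _ => ?_
        rw [← zpow_add₀ (Nat.cast_ne_zero.2 (hp0 i)), hab]
        simp
      rw [← this, he, one_mul]
    have hnat : (∏ i, p i ^ a i) = ∏ i, p i ^ b i := by
      have := hprod
      simp only [zpow_natCast] at this
      exact_mod_cast this
    have := eq_of_prod_prime_pow_eq hp hinj hnat
    rw [hab, this]
    funext i; simp
  intro e e' h
  have : tpow p (e - e') = 1 := by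
    rw [sub_eq_add_neg, tpow_add hp0, tpow_neg, h, mul_inv_cancel₀ (tpow_ne_zero hp0 _)]
  exact sub_eq_zero.1 (h1 _ this)

/-- `z ~ z'` iff `z = z' · t^e` for some `e ∈ ℤ^m`. [folklore] -/
def degRel (p : Fin m → ℕ) (z z' : ℂ) : Prop := ∃ e : Fin m → ℤ, z = z' * tpow p e

/-- The class of `z`. [folklore] -/
def degClass (p : Fin m → ℕ) (z : ℂ) : Set ℂ := {w | degRel p z w}

/-- A chosen representative of the class of `z` (depends only on the class). [folklore] -/
def degRep (p : Fin m → ℕ) (z : ℂ) : ℂ := Classical.epsilon fun w => w ∈ degClass p z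

/-- `~` is reflexive. [folklore] -/
theorem degRel_refl (z : ℂ) : degRel p z z := ⟨0, by simp⟩

/-- `~` is symmetric. [folklore] -/
theorem degRel_symm (hp0 : ∀ i, p i ≠ 0) {z z' : ℂ} (h : degRel p z z') : degRel p z' z := by
  obtain ⟨e, rfl⟩ := h
  exact ⟨-e, by rw [tpow_neg, mul_assoc, mul_inv_cancel₀ (tpow_ne_zero hp0 e), mul_one]⟩

/-- `~` is transitive. [folklore] -/
theorem degRel_trans (hp0 : ∀ i, p i ≠ 0) {z z' z'' : ℂ} (h : degRel p z z') (h' : degRel p z' z'') :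
    degRel p z z'' := by
  obtain ⟨e, rfl⟩ := h
  obtain ⟨e', rfl⟩ := h'
  exact ⟨e' + e, by rw [tpow_add hp0, mul_assoc]⟩

/-- Related numbers have the same class. [folklore] -/
theorem degClass_eq_of_degRel (hp0 : ∀ i, p i ≠ 0) {z z' : ℂ} (h : degRel p z z') :
    degClass p z = degClass p z' := by
  ext w
  exact ⟨fun hw => degRel_trans hp0 (degRel_symm hp0 h) hw, fun hw => degRel_trans hp0 h hw⟩

/-- The chosen representative lies in the class. [folklore] -/
theorem degRep_mem (z : ℂ) : degRel p z (degRep p z) :=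
  Classical.epsilon_spec (p := fun w => w ∈ degClass p z) ⟨z, degRel_refl z⟩

/-- Related numbers have the same representative. [folklore] -/
theorem degRep_eq_of_degRel (hp0 : ∀ i, p i ≠ 0) {z z' : ℂ} (h : degRel p z z') :
    degRep p z = degRep p z' := by
  unfold degRep; rw [degClass_eq_of_degRel hp0 h]

/-- The **degree** `deg p z ∈ ℤ^m` of a complex number relative to the representative of its class:
`z = degRep p z · t^{deg p z}`.  Junk value: for `z = 0` the class is `{0}`, the defining identity
holds for every exponent, and `deg p 0` is an unspecified vector; all statements about `deg` that
matter (`deg_mul_tpow`, `deg_mul_prime`) assume `z ≠ 0`. [folklore] -/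
def deg (p : Fin m → ℕ) (z : ℂ) : Fin m → ℤ := Classical.choose (degRep_mem (p := p) z)

/-- Defining property of `deg`. [folklore] -/
theorem deg_spec (z : ℂ) : z = degRep p z * tpow p (deg p z) := Classical.choose_spec (degRep_mem z)

/-- **Additivity of the degree**: `deg (z · t^e) = deg z + e` for `z ≠ 0`. [folklore] -/
theorem deg_mul_tpow (hp : ∀ i, (p i).Prime) (hinj : Function.Injective p) {z : ℂ} (hz : z ≠ 0)
    (e : Fin m → ℤ) : deg p (z * tpow p e) = deg p z + e := by
  have hp0 : ∀ i, p i ≠ 0 := fun i => (hp i).ne_zero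
  have hrel : degRel p (z * tpow p e) z := ⟨e, rfl⟩
  have hrep : degRep p (z * tpow p e) = degRep p z := degRep_eq_of_degRel hp0 hrel
  have h1 := deg_spec (p := p) (z * tpow p e)
  have h2 := deg_spec (p := p) z
  rw [hrep] at h1
  set w := degRep p z
  have hw : w ≠ 0 := by intro hw0; rw [hw0, zero_mul] at h2; exact hz h2
  have : tpow p (deg p (z * tpow p e)) = tpow p (deg p z + e) := by
    apply mul_left_cancel₀ hw
    rw [← h1, tpow_add hp0, ← mul_assoc, ← h2]
  exact tpow_injective hp hinj this

/-- In particular `deg (z · p_i) = deg z + e_i`. [folklore] -/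
theorem deg_mul_prime (hp : ∀ i, (p i).Prime) (hinj : Function.Injective p) {z : ℂ} (hz : z ≠ 0)
    (i : Fin m) : deg p (z * p i) = deg p z + Pi.single i 1 := by
  rw [← deg_mul_tpow hp hinj hz, tpow_single]

/-- And `deg (t^e · z) = deg z + e`. [folklore] -/
theorem deg_tpow_mul (hp : ∀ i, (p i).Prime) (hinj : Function.Injective p) {z : ℂ} (hz : z ≠ 0)
    (e : Fin m → ℤ) : deg p (tpow p e * z) = deg p z + e := by
  rw [mul_comm, deg_mul_tpow hp hinj hz]

end PrimeWeights

end TorusGrading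

/-! ### Regrouping internal direct sums -/

section Regroup

variable {R M : Type*} [Ring R] [AddCommGroup M] [Module R M] {ι κ : Type*} [DecidableEq ι]
  [DecidableEq κ]

/-- Regrouping an internal direct sum `M = ⊕_i A_i` along a map `f : ι → κ` of index types gives
the internal direct sum `M = ⊕_k (⨆_{f i = k} A_i)`. [folklore] -/
theorem isInternal_fiber {A : ι → Submodule R M} (h : DirectSum.IsInternal A) (f : ι → κ) :
    DirectSum.IsInternal fun k : κ => ⨆ i ∈ f ⁻¹' {k}, A i := by
  rw [DirectSum.isInternal_submodule_iff_iSupIndep_and_iSup_eq_top]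
  have hind := h.submodule_iSupIndep
  constructor
  · intro k
    have hdisj : Disjoint (f ⁻¹' {k}) (f ⁻¹' {k})ᶜ := disjoint_compl_right
    refine (hind.disjoint_biSup_biSup hdisj).mono_right ?_
    refine iSup₂_le fun k' hk' => iSup₂_le fun i hi => ?_
    have hi' : i ∈ (f ⁻¹' {k})ᶜ := by
      simp only [Set.mem_compl_iff, Set.mem_preimage, Set.mem_singleton_iff]
      simp only [Set.mem_preimage, Set.mem_singleton_iff] at hi
      rw [hi]; exact hk'
    exact le_biSup A hi'
  · rw [eq_top_iff, ← h.submodule_iSup_eq_top]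
    refine iSup_le fun i => ?_
    have : A i ≤ ⨆ j ∈ f ⁻¹' {f i}, A j := le_biSup A (by simp)
    exact this.trans (le_iSup (fun k => ⨆ j ∈ f ⁻¹' {k}, A j) (f i))

end Regroup

/-! ### The `ℤ^m`-grading attached to an endomorphism -/

namespace TorusGrading

section Graded

variable {m : ℕ} (p : Fin m → ℕ) {V W : Type*} [AddCommGroup V] [Module ℂ V] [AddCommGroup W]
  [Module ℂ W]

/-- The degree-`d` piece of the grading attached to `Q`: the sum of the generalised eigenspaces of
`Q` whose eigenvalue has degree `d` (LR17 §6: the weight space of weight `d` of the lifted torus,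
here produced from one generic element).  Junk value: the generalised `0`-eigenspace of `Q` lands
in the piece of the unspecified degree `deg p 0`; it is `⊥` when `Q` is injective, which is why
`map_gradedPiece_le` assumes injectivity. [cite: LandsbergRessayre2017, §6] -/
def gradedPiece (Q : Module.End ℂ V) (d : Fin m → ℤ) : Submodule ℂ V :=
  ⨆ β ∈ (deg p) ⁻¹' {d}, Q.maxGenEigenspace β

/-- The pieces form an internal direct sum decomposition (finite dimension, `ℂ` algebraically
closed). [folklore] -/
theorem gradedPiece_isInternal [FiniteDimensional ℂ V] (Q : Module.End ℂ V) :
    DirectSum.IsInternal (gradedPiece p Q) := by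
  classical
  have h : DirectSum.IsInternal fun β : ℂ => Q.maxGenEigenspace β :=
    DirectSum.isInternal_submodule_of_iSupIndep_of_iSup_eq_top Q.independent_maxGenEigenspace
      (Module.End.iSup_maxGenEigenspace_eq_top Q)
  exact isInternal_fiber h (deg p)

/-- A generalised eigenspace lies in the piece of the degree of its eigenvalue. [folklore] -/
theorem maxGenEigenspace_le_gradedPiece (Q : Module.End ℂ V) (β : ℂ) :
    Q.maxGenEigenspace β ≤ gradedPiece p Q (deg p β) :=
  le_biSup (fun β => Q.maxGenEigenspace β) (show β ∈ deg p ⁻¹' {deg p β} by simp)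

variable {p}

/-- **Degree shift**: if `P ∘ M = t^e • (M ∘ Q)` with `Q` injective, then `M` maps the degree-`d`
piece of `Q` into the degree-`(d + e)` piece of `P`.  (With `e = 0` for `Λ` and `e = e_i` for the
row-`i` coefficient matrices this is the graded structure of `Ã` used in LR17 §6.) [cite: LandsbergRessayre2017, §6] -/
theorem map_gradedPiece_le (hp : ∀ i, (p i).Prime) (hinj : Function.Injective p)
    {P : Module.End ℂ W} {Q : Module.End ℂ V} (hQ : Function.Injective Q) {M : V →ₗ[ℂ] W}
    {e : Fin m → ℤ} (h : P ∘ₗ M = tpow p e • (M ∘ₗ Q)) (d : Fin m → ℤ) :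
    (gradedPiece p Q d).map M ≤ gradedPiece p P (d + e) := by
  rw [gradedPiece, Submodule.map_iSup]
  refine iSup_le fun β => ?_
  rw [Submodule.map_iSup]
  refine iSup_le fun hβ => ?_
  simp only [Set.mem_preimage, Set.mem_singleton_iff] at hβ
  by_cases hβ0 : β = 0
  · subst hβ0
    rw [maxGenEigenspace_zero_eq_bot_of_injective Q hQ, Submodule.map_bot]
    exact bot_le
  · refine (map_maxGenEigenspace_le_of_comp_eq_smul P Q M _ h β).trans ?_
    have hdeg : deg p (tpow p e * β) = d + e := by rw [deg_tpow_mul hp hinj hβ0, hβ]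
    rw [← hdeg]
    exact maxGenEigenspace_le_gradedPiece p P _

/-- The case `e = 0` (intertwiners, e.g. `Λ` with `P Λ = Λ Q`): degree is preserved — here no
hypothesis on `p` or `Q` is needed (each generalised eigenspace of `Q` is mapped into the one of `P`
with the same eigenvalue). [cite: LandsbergRessayre2017, §6] -/
theorem map_gradedPiece_le_of_comp_eq {P : Module.End ℂ W} {Q : Module.End ℂ V} {M : V →ₗ[ℂ] W}
    (h : P ∘ₗ M = M ∘ₗ Q) (d : Fin m → ℤ) :
    (gradedPiece p Q d).map M ≤ gradedPiece p P d := by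
  have h' : P ∘ₗ M = (1 : ℂ) • (M ∘ₗ Q) := by rw [one_smul]; exact h
  rw [gradedPiece, Submodule.map_iSup]
  refine iSup_le fun β => ?_
  rw [Submodule.map_iSup]
  refine iSup_le fun hβ => ?_
  simp only [Set.mem_preimage, Set.mem_singleton_iff] at hβ
  refine (map_maxGenEigenspace_le_of_comp_eq_smul P Q M 1 h' β).trans ?_
  rw [one_mul, ← hβ]
  exact maxGenEigenspace_le_gradedPiece p P β

end Graded

end TorusGrading

end Literature.Computability.AlgebraicComplexity
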